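import Summits.HodgeConjecture.HodgeConjecture.Theorems.Ring2WeilCoverageSurfacePowers
import Literature.AlgebraicGeometry.HodgeTheory.QuaternionMinimalPowersHodgeClasses
import Literature.AlgebraicGeometry.ComplexMultiplication.EndAlgebraDegreeDvdTwoDim
import Literature.AlgebraicGeometry.Motives.AbelianVarietyEndAlgebraInstances
import Mathlib.RingTheory.SimpleRing.Congr
import Mathlib.Algebra.Central.Basic
import HarnessLib

/-!
# Ring 2 · Weil-type family-coverage census (ring2-b05, gen 62) — THE `Y²`-LOCI: all powers of an abelian variety
  isogenous to a power of a fourfold carrying a quaternion algebra over a real quadratic field (type II(2)), in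
  EMBEDDING FORM

research route conditional on HC_CM; not a corollary; Q11.4-sentence-2 already refuted in dim ≥ 3.
`HC_CM` (`Theses.RankFourFaces.CMAbelianHodge`, by name) does not occur in this file; no case of the Hodge conjecture is
claimed beyond the cited theorems, all of which are THEOREMS of the tree (no named fact enters). Cell `pub-hodge-ring2`,
seat `ring2-b05` (census «## b05 (g ≥ 8 / powers)», block b05.17 P.S. 3 — the ERRATUM: two of the 58 (α)-loci of the
binary-polyhedral census, `2I (0;5,5′,6,10)` and `2I (0;5,5′,6,10′)` (genus 81), have a NON-split non-compact Clifford
component `Q_nc` — the quaternion division algebra over `ℚ(√5)` ramified at `(2)` and `(√5)` — so that PROPOSITION (α)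
gives `P_t ~ Y_t²` with an EMBEDDING `Q_nc ↪ End⁰(Y_t)`, `dim Y_t = 4 = 2[ℚ(√5):ℚ]`, at every member, instead of
`P_t ~ B_t⁴`). No definition, no named fact introduced, no `sorry`.

THE POINT OF THE FILE. The tree's theorem `hodgeConjectureFor_of_isIsogenous_powSucc_of_isSimple_quaternion_of_dim_eq`
(`Literature/AlgebraicGeometry/HodgeTheory/QuaternionMinimalPowersHodgeClasses`: Banaszak–Gajda–Krasoń 2006 Thm. 7.34 /
Murty 1988 Thm. 2, type III excluded by Shimura 1963 §4) is keyed on the instances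
`[Algebra K Y.endAlgebra] [IsQuaternionAlgebra K Y.endAlgebra]` — «`End⁰(Y)` IS a quaternion algebra over `K`».  What a
census (or a monodromy computation) delivers is weaker on its face: a quaternion algebra `Q` over a totally real `K` and a
`ℚ`-algebra map `Q →ₐ[ℚ] End⁰(Y)` (for the census: `Y_t` the image of an idempotent of `M₂(Q_nc) ⊆ End⁰(P_t)`).  For a
SIMPLE `Y` with `dim Y = 2[K:ℚ]` the two agree — Swinnerton-Dyer's divisibility `[End⁰(Y):ℚ] ∣ 2 dim Y` and the
injectivity of maps out of simple rings force `Q ≃ End⁰(Y)` — and this file performs that transport once and for all: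

* §1 `finrank_dvd_two_mul_dim_of_algHom_of_forall_isUnit` — for ANY complex abelian variety `W` and any
  finite-dimensional `ℚ`-algebra `Q` all of whose non-zero elements are units, a `ℚ`-algebra map `Q →ₐ[ℚ] End⁰(W)` forces
  `dim_ℚ Q ∣ 2 dim W` (`H¹(W(ℂ); ℚ)` is a free `Qᵐᵒᵖ`-module through the rational representation; Swinnerton-Dyer §10,
  proof of Lemma 44, with `Q` in place of `End⁰`).  This is the ISOTYPY LEMMA of the census block: a division algebra of
  `ℚ`-dimension 8 acts on no abelian variety of dimension 1, 2 or 3.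
* §2 `nonempty_algEquiv_of_isSimple_of_quaternionAlgHom_of_dim_eq` — `Y` simple, `Q` a quaternion algebra over a number
  field `K`, `φ : Q →ₐ[ℚ] End⁰(Y)`, `dim Y = 2[K:ℚ]` ⟹ `φ` is bijective (`Q ≃ₐ[ℚ] End⁰(Y)`).
* §3 `isStablyNondegenerate_of_isSimple_of_quaternionAlgHom_of_dim_eq` — with `K` totally real: **`B = D` on every
  power of `Y`** (the `IsQuaternionAlgebra K End⁰(Y)` structure is transported along §2 and the tree's theorem applied);
  `hodgeConjectureFor_powSucc_of_isIsogenous_powSucc_of_isSimple_of_quaternionAlgHom` — **the Hodge conjecture for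
  every power of every `P` isogenous to a power of such a `Y`, UNCONDITIONAL.**
* §4 the census shapes: `isStablyNondegenerate_of_dim_eq_one` (an elliptic curve, as a retract of `E × E`),
  `isStablyNondegenerate_of_isIsogenous_powSucc_of_dim_le_two` (anything isogenous to a power of a curve or a surface —
  the CM members `Y_t ~ X_t²`, `Y_t ~ E_t⁴` of the two loci), and
  `hodgeConjectureFor_powSucc_of_isIsogenous_sq_of_quaternionAlgHom_real_quadratic` (the non-CM members: `Y_t` simple,
  `[K:ℚ] = 2`, `dim Y_t = 4`, `P_t ~ Y_t²`).

## References
* [BanaszakGajdaKrason2006] G. Banaszak, W. Gajda, P. Krasoń, Doc. Math. Extra Vol. Coates (2006), Thm. 7.34.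
* [Murty1988] V. Kumar Murty, Proc. AMS 104 (1988), Thm. 2.
* [SwinnertonDyer1974] H. P. F. Swinnerton-Dyer, Analytic Theory of Abelian Varieties (1974), §10, Lemma 44 (proof).
* [MumfordAV1970] D. Mumford, Abelian Varieties (1970), §19 Cor. 2 of Thm. 1, §21 Thm. 2.
* [Shimura1963AnalyticFamilies] G. Shimura, Ann. of Math. 78 (1963), §4.
* [Abdulali2016TateTwists] S. Abdulali, in: Recent Advances in Hodge Theory (CUP 2016), §8.1 (2).
* [vanGeemen1994HodgeAV] B. van Geemen, LNM 1594 (1994), §2.4–2.5, Lemma 3.7, Thm. 4.3.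
-/

set_option linter.dupNamespace false -- `Summit.HodgeConjecture.HodgeConjecture.…` (summit = problem) trips it

noncomputable section

open CategoryTheory

namespace Summit.HodgeConjecture.HodgeConjecture.Ring2.WeilCoverage

open Literature.AlgebraicGeometry Literature.AlgebraicGeometry.Motives
open Literature.AlgebraicGeometry.Motives.AbelianVariety
open Literature.AlgebraicGeometry.HodgeTheory
open Literature.AlgebraicGeometry.ComplexMultiplication
open Literature.AlgebraicTopology.SingularHomology
open Literature.NumberTheory.Automorphic (IsQuaternionAlgebra)

/-! ### §1 A division algebra acting on an abelian variety: `dim_ℚ Q ∣ 2 dim W` -/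

/-- **ISOTYPY LEMMA (dimension part).** If a `ℚ`-algebra `Q` all of whose non-zero elements are units maps to
`End⁰(W)` by a `ℚ`-algebra homomorphism, then `dim_ℚ Q ∣ 2 dim W`: `H¹(W(ℂ); ℚ) ≅ ℚ^{2 dim W}` is a (free) module
over the division ring `Qᵐᵒᵖ` through `φ` and the rational representation (Swinnerton-Dyer §10, proof of Lemma 44,
with `Q` for `End⁰(W)`; the tree's `finrank_dvd_finrank_of_module_mulOpposite`). In particular a division algebra of
`ℚ`-dimension 8 acts on no abelian variety of dimension 1, 2 or 3. [cite: SwinnertonDyer1974, §10 proof of Lemma 44]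
[cite: MumfordAV1970, §19 Cor. 2 of Thm. 1 (p. 174)] -/
theorem finrank_dvd_two_mul_dim_of_algHom_of_forall_isUnit {Q : Type} [Ring Q] [Algebra ℚ Q] [Nontrivial Q]
    (hQ : ∀ x : Q, x ≠ 0 → IsUnit x) {W : AbelianVariety ℂ} (φ : Q →ₐ[ℚ] W.endAlgebra) :
    Module.finrank ℚ Q ∣ 2 * W.dim := by
  -- `H¹(W(ℂ); ℚ)` as a module over `Qᵐᵒᵖ` through `x ↦ (φ x)^*`
  let ψ : Qᵐᵒᵖ →+* Module.End ℚ (bettiCohomology W.X 1) :=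
    { toFun := fun x => MulOpposite.unop (bettiRep W (φ (MulOpposite.unop x)))
      map_one' := by rw [MulOpposite.unop_one, map_one, map_one, MulOpposite.unop_one]
      map_mul' := fun x y => by rw [MulOpposite.unop_mul, map_mul, map_mul, MulOpposite.unop_mul]
      map_zero' := by rw [MulOpposite.unop_zero, map_zero, map_zero, MulOpposite.unop_zero]
      map_add' := fun x y => by rw [MulOpposite.unop_add, map_add, map_add, MulOpposite.unop_add] }
  letI : Module Qᵐᵒᵖ (bettiCohomology W.X 1) := Module.compHom _ ψ
  haveI : IsScalarTower ℚ Qᵐᵒᵖ (bettiCohomology W.X 1) := ⟨fun q x v => by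
    change MulOpposite.unop (bettiRep W (φ (MulOpposite.unop (q • x)))) v =
      q • MulOpposite.unop (bettiRep W (φ (MulOpposite.unop x))) v
    rw [MulOpposite.unop_smul, map_smul, map_smul, MulOpposite.unop_smul, LinearMap.smul_apply]⟩
  rw [← finrank_bettiCohomology_one W]
  exact finrank_dvd_finrank_of_module_mulOpposite hQ

/-! ### §2 A quaternion algebra inside `End⁰(Y)`, `Y` simple of dimension `2[K:ℚ]`: the embedding is an isomorphism -/

section Transport

variable {Y : AbelianVariety ℂ} (K : Type) {Q : Type} [Field K] [NumberField K] [Ring Q] [Algebra ℚ Q] [Algebra K Q]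
  [IsScalarTower ℚ K Q] [IsQuaternionAlgebra K Q]

include K in
/-- `dim_ℚ Q = 4 [K:ℚ]` for a quaternion algebra `Q` over `K` (tower law). [cite: MumfordAV1970, §21 Thm. 2 (type II/III: `[End⁰:ℚ] = 4e`)] -/
theorem finrank_rat_eq_four_mul_of_isQuaternionAlgebra : Module.finrank ℚ Q = 4 * Module.finrank ℚ K := by
  rw [← Module.finrank_mul_finrank ℚ K Q, IsQuaternionAlgebra.finrank_eq_four (K := K) (D := Q), mul_comm]

include K in
/-- `Q` is finite-dimensional over `ℚ`. [cite: MumfordAV1970, §21 Thm. 2] -/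
theorem finite_rat_of_isQuaternionAlgebra : Module.Finite ℚ Q := Module.Finite.trans K Q

omit [NumberField K] [IsScalarTower ℚ K Q] in
include K in
/-- A `ℚ`-algebra map from a quaternion algebra to `End⁰(Y)`, `dim Y > 0`, is injective (simple rings have no proper
quotients). [cite: MumfordAV1970, §19 Cor. 2 of Thm. 1 (p. 174)] -/
theorem quaternionAlgHom_injective (hY : 0 < Y.dim) (φ : Q →ₐ[ℚ] Y.endAlgebra) : Function.Injective φ := by
  haveI : IsSimpleRing Q := IsQuaternionAlgebra.isSimpleRing' K Q
  haveI : Nontrivial Y.endAlgebra := nontrivial_endAlgebra_of_dim_pos hY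
  exact RingHom.injective φ.toRingHom

include K in
/-- **`[End⁰(Y) : ℚ] = 4[K:ℚ] = dim_ℚ Q`** for `Y` SIMPLE with `dim Y = 2[K:ℚ]` receiving a quaternion algebra `Q`
over `K`: `dim_ℚ Q ≤ [End⁰(Y):ℚ]` (injectivity) and `[End⁰(Y):ℚ] ∣ 2 dim Y = dim_ℚ Q` (Swinnerton-Dyer).
[cite: SwinnertonDyer1974, §10 proof of Lemma 44] [cite: MumfordAV1970, §19 Cor. 2 of Thm. 1 (p. 174)] -/
theorem finrank_endAlgebra_eq_of_isSimple_of_quaternionAlgHom_of_dim_eq (hY : Y.IsSimple)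
    (φ : Q →ₐ[ℚ] Y.endAlgebra) (hdim : Y.dim = 2 * Module.finrank ℚ K) :
    Module.finrank ℚ Y.endAlgebra = Module.finrank ℚ Q := by
  haveI : Module.Finite ℚ Q := finite_rat_of_isQuaternionAlgebra (K := K)
  have hK : 0 < Module.finrank ℚ K := Module.finrank_pos
  have hQ : Module.finrank ℚ Q = 4 * Module.finrank ℚ K := finrank_rat_eq_four_mul_of_isQuaternionAlgebra (K := K)
  have hφ : Function.Injective φ.toLinearMap := quaternionAlgHom_injective (K := K) (by rw [hdim]; omega) φ
  have hle : Module.finrank ℚ Q ≤ Module.finrank ℚ Y.endAlgebra := LinearMap.finrank_le_finrank_of_injective hφ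
  have hdvd : Module.finrank ℚ Y.endAlgebra ∣ Module.finrank ℚ Q := by
    have h := finrank_endAlgebra_dvd_two_mul_dim hY
    rwa [hdim, ← mul_assoc, show (2 : ℕ) * 2 = 4 from rfl, ← hQ] at h
  exact le_antisymm (Nat.le_of_dvd (by rw [hQ]; omega) hdvd) hle

include K in
/-- **The embedding is an isomorphism**: `Y` simple, `Q` quaternion over a number field `K`, `φ : Q →ₐ[ℚ] End⁰(Y)`,
`dim Y = 2[K:ℚ]` ⟹ `φ` is bijective, `Q ≃ₐ[ℚ] End⁰(Y)` extending `φ`. [cite: SwinnertonDyer1974, §10 proof of Lemma 44]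
[cite: MumfordAV1970, §19 Cor. 2 of Thm. 1 and §21 Thm. 2] -/
theorem bijective_of_isSimple_of_quaternionAlgHom_of_dim_eq (hY : Y.IsSimple) (φ : Q →ₐ[ℚ] Y.endAlgebra)
    (hdim : Y.dim = 2 * Module.finrank ℚ K) : Function.Bijective φ := by
  haveI : Module.Finite ℚ Q := finite_rat_of_isQuaternionAlgebra (K := K)
  have hK : 0 < Module.finrank ℚ K := Module.finrank_pos
  have hφ : Function.Injective φ.toLinearMap := quaternionAlgHom_injective (K := K) (by rw [hdim]; omega) φ
  have heq : Module.finrank ℚ Q = Module.finrank ℚ Y.endAlgebra :=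
    (finrank_endAlgebra_eq_of_isSimple_of_quaternionAlgHom_of_dim_eq K hY φ hdim).symm
  exact ⟨hφ, (@LinearMap.injective_iff_surjective_of_finrank_eq_finrank ℚ Q _ _ _ Y.endAlgebra Ring.toAddCommGroup
    Algebra.toModule _ (AbelianVariety.endAlgebra.instModuleFinite Y) heq φ.toLinearMap).1 hφ⟩

include K in
/-- The `ℚ`-algebra isomorphism `Q ≃ₐ[ℚ] End⁰(Y)` extending `φ`. [cite: MumfordAV1970, §19 Cor. 2 of Thm. 1 and §21 Thm. 2] -/
theorem nonempty_algEquiv_of_isSimple_of_quaternionAlgHom_of_dim_eq (hY : Y.IsSimple) (φ : Q →ₐ[ℚ] Y.endAlgebra)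
    (hdim : Y.dim = 2 * Module.finrank ℚ K) : ∃ e : Q ≃ₐ[ℚ] Y.endAlgebra, ∀ x, e x = φ x :=
  ⟨AlgEquiv.ofBijective φ (bijective_of_isSimple_of_quaternionAlgHom_of_dim_eq K hY φ hdim), fun _ => rfl⟩

/-! ### §3 `B = D` on all powers; the Hodge conjecture for every power of every `P ~ Y^{N+1}` -/

include K in
/-- **THEOREM (embedding form of the type-II-minimal theorem).** Let `Y` be a SIMPLE complex abelian variety, `K` a
totally real number field, `Q` a quaternion algebra over `K` with a `ℚ`-algebra map `Q →ₐ[ℚ] End⁰(Y)`, and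
`dim Y = 2[K:ℚ]`. Then `B•(Y^{N+1}) = D•(Y^{N+1}) ⊗ ℂ` for every `N` — `Y` is stably nondegenerate. PROOF: by §2 the map is
an isomorphism; transporting the `K`-algebra structure makes `End⁰(Y)` a quaternion algebra over `K`
(`Algebra.IsCentral.of_algEquiv`, `IsSimpleRing.of_ringEquiv`, `finrank` along the equivalence), and the tree's
`AbelianVariety.isDivisorGenerated_powSucc_of_isSimple_quaternion_of_dim_eq` (Banaszak–Gajda–Krasoń Thm. 7.34 / Murty
Thm. 2; type III impossible by Shimura) applies. UNCONDITIONAL. [cite: BanaszakGajdaKrason2006, Thm. 7.34]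
[cite: Murty1988, Thm. 2 (p. 67)] [cite: Shimura1963AnalyticFamilies, §4] -/
theorem isStablyNondegenerate_of_isSimple_of_quaternionAlgHom_of_dim_eq [NumberField.IsTotallyReal K]
    (hY : Y.IsSimple) (φ : Q →ₐ[ℚ] Y.endAlgebra) (hdim : Y.dim = 2 * Module.finrank ℚ K) :
    IsStablyNondegenerate Y := by
  haveI hQs : IsSimpleRing Q := IsQuaternionAlgebra.isSimpleRing' K Q
  obtain ⟨e, -⟩ := nonempty_algEquiv_of_isSimple_of_quaternionAlgHom_of_dim_eq K hY φ hdim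
  -- transport the `K`-algebra structure of `Q` to `End⁰(Y)` along `e`
  letI : Algebra K Y.endAlgebra := (e.toAlgHom.toRingHom.comp (algebraMap K Q)).toAlgebra' fun c x => by
    obtain ⟨y, rfl⟩ := e.surjective x
    change e (algebraMap K Q c) * e y = e y * e (algebraMap K Q c)
    rw [← map_mul, ← map_mul, Algebra.commutes]
  have halg : ∀ k : K, algebraMap K Y.endAlgebra k = e (algebraMap K Q k) := fun _ => rfl
  haveI : IsScalarTower ℚ K Y.endAlgebra := IsScalarTower.of_algebraMap_eq fun q => by
    rw [halg, ← IsScalarTower.algebraMap_apply ℚ K Q, AlgEquiv.commutes]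
  let eK : Q ≃ₐ[K] Y.endAlgebra := AlgEquiv.ofRingEquiv (f := e.toRingEquiv) fun k => (halg k).symm
  haveI : IsQuaternionAlgebra K Y.endAlgebra :=
    { isCentral := Algebra.IsCentral.of_algEquiv K Q Y.endAlgebra eK
      isSimpleRing := IsSimpleRing.of_ringEquiv e.toRingEquiv hQs
      finrank_eq_four := by
        rw [← eK.toLinearEquiv.finrank_eq, IsQuaternionAlgebra.finrank_eq_four (K := K) (D := Q)] }
  exact fun N => AbelianVariety.isDivisorGenerated_powSucc_of_isSimple_quaternion_of_dim_eq (K := K) hY hdim N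

include K in
/-- `B = D` on every power `Y^{N+1}`. [cite: BanaszakGajdaKrason2006, Thm. 7.34] [cite: Murty1988, Thm. 2 (p. 67)] -/
theorem isDivisorGenerated_powSucc_of_isSimple_of_quaternionAlgHom_of_dim_eq [NumberField.IsTotallyReal K]
    (hY : Y.IsSimple) (φ : Q →ₐ[ℚ] Y.endAlgebra) (hdim : Y.dim = 2 * Module.finrank ℚ K) (N : ℕ) :
    IsDivisorGenerated (Y.powSucc N) :=
  isStablyNondegenerate_of_isSimple_of_quaternionAlgHom_of_dim_eq K hY φ hdim N

include K in
/-- **THE HODGE CONJECTURE FOR EVERY POWER OF EVERY ABELIAN VARIETY ISOGENOUS TO A POWER OF SUCH A `Y` —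
UNCONDITIONAL** (`Y` simple, `Q ↪ End⁰(Y)` a quaternion algebra over a totally real `K`, `dim Y = 2[K:ℚ]`; stable
nondegeneracy is an isogeny invariant and passes to powers; Lefschetz `(1,1)`). The census shape: the non-CM members of
the two `Y²`-loci `2I (0;5,5′,6,10)`, `(0;5,5′,6,10′)` — `P_t ~ Y_t²`, `Q_nc ↪ End⁰(Y_t)`, `K = ℚ(√5)`.
[cite: BanaszakGajdaKrason2006, Thm. 7.34] [cite: Murty1988, Thm. 2 (p. 67)] [cite: vanGeemen1994HodgeAV, Lemma 3.7] -/
theorem hodgeConjectureFor_powSucc_of_isIsogenous_powSucc_of_isSimple_of_quaternionAlgHom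
    [NumberField.IsTotallyReal K] (hY : Y.IsSimple) (φ : Q →ₐ[ℚ] Y.endAlgebra)
    (hdim : Y.dim = 2 * Module.finrank ℚ K) {P : AbelianVariety ℂ} {N : ℕ} (hP : P.IsIsogenous (Y.powSucc N))
    (k : ℕ) : HodgeConjectureFor (P.powSucc k).dim (P.powSucc k).X :=
  (((isStablyNondegenerate_of_isSimple_of_quaternionAlgHom_of_dim_eq K hY φ hdim).powSucc N).of_isIsogenous
    hP).hodgeConjectureFor_powSucc k

include K in
/-- In particular HC for `P` itself (`k = 0`) and for `Y` (`P = Y`, `N = 0`). [cite: BanaszakGajdaKrason2006, Thm. 7.34] -/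
theorem hodgeConjectureFor_of_isIsogenous_powSucc_of_isSimple_of_quaternionAlgHom [NumberField.IsTotallyReal K]
    (hY : Y.IsSimple) (φ : Q →ₐ[ℚ] Y.endAlgebra) (hdim : Y.dim = 2 * Module.finrank ℚ K) {P : AbelianVariety ℂ}
    {N : ℕ} (hP : P.IsIsogenous (Y.powSucc N)) : HodgeConjectureFor P.dim P.X :=
  hodgeConjectureFor_powSucc_of_isIsogenous_powSucc_of_isSimple_of_quaternionAlgHom K hY φ hdim hP 0

end Transport

/-! ### §4 The census shapes of the two `Y²`-loci: non-CM members (`Y_t` simple, `K` real quadratic) and CM members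
(`Y_t ~ X_t²`, `X_t` a surface, or `Y_t ~ E_t⁴`) -/

/-- **An elliptic curve is stably nondegenerate** (`E` is a retract of `E × E`, which is stably nondegenerate by
Tate–Imai / van Geemen Thm. 4.3, the tree's `isStablyNondegenerate_prod_of_dim_eq_one`).
[cite: vanGeemen1994HodgeAV, Thm. 4.3] [cite: Abdulali2016TateTwists, §8.1 (2)] -/
theorem isStablyNondegenerate_of_dim_eq_one (E : AbelianVariety ℂ) (h1 : E.dim = 1) : IsStablyNondegenerate E :=
  IsStablyNondegenerate.of_retract_powSucc (P := E.prod E) (K₀ := 0)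
    (AbelianVariety.prodLift (𝟙 E) (𝟙 E)) (AbelianVariety.fst E E) (AbelianVariety.prodLift_fst _ _)
    (isStablyNondegenerate_prod_of_dim_eq_one h1 h1)

/-- **Anything isogenous to a power of a curve or of a surface is stably nondegenerate** (the CM members of the two
loci: `Y_t ~ X_t²` with `X_t` a CM surface, or `Y_t ~ E_t⁴`). [cite: Abdulali2016TateTwists, §8.1 (2)]
[cite: vanGeemen1994HodgeAV, §3.6 (p. 236) and Thm. 4.3] -/
theorem isStablyNondegenerate_of_isIsogenous_powSucc_of_dim_le_two {X Y : AbelianVariety ℂ}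
    (hX : X.dim = 1 ∨ X.dim = 2) {n : ℕ} (hY : Y.IsIsogenous (X.powSucc n)) : IsStablyNondegenerate Y := by
  rcases hX with h1 | h2
  · exact ((isStablyNondegenerate_of_dim_eq_one X h1).powSucc n).of_isIsogenous hY
  · exact ((isStablyNondegenerate_of_dim_eq_two X h2).powSucc n).of_isIsogenous hY

/-- **CM members: HC for every power of every `P ~ Y^{N+1}` with `Y ~ X^{n+1}`, `X` a curve or a surface** — tree
theorems only (surface powers, b05 g59; curves by the retract above). [cite: Abdulali2016TateTwists, §8.1 (2)]
[cite: MoonenZarhin1999LowDim, §2 (2.2) and Cor. (3.9)] -/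
theorem hodgeConjectureFor_powSucc_of_isIsogenous_powSucc_of_isIsogenous_powSucc_of_dim_le_two
    {X Y P : AbelianVariety ℂ} (hX : X.dim = 1 ∨ X.dim = 2) {n : ℕ} (hY : Y.IsIsogenous (X.powSucc n)) {N : ℕ}
    (hP : P.IsIsogenous (Y.powSucc N)) (k : ℕ) : HodgeConjectureFor (P.powSucc k).dim (P.powSucc k).X :=
  (((isStablyNondegenerate_of_isIsogenous_powSucc_of_dim_le_two hX hY).powSucc N).of_isIsogenous
    hP).hodgeConjectureFor_powSucc k

/-- **Non-CM members: the census instance.** `K` a REAL QUADRATIC field (`[K:ℚ] = 2`, e.g. `ℚ(√5)`), `Q` a quaternion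
algebra over `K` (e.g. the one ramified at `(2)` and `(√5)`), `Y` a SIMPLE abelian FOURFOLD with `Q →ₐ[ℚ] End⁰(Y)`,
`P ~ Y² = Y.powSucc 1`: **HC holds for every power of `P`, unconditionally.** [cite: BanaszakGajdaKrason2006, Thm. 7.34]
[cite: Murty1988, Thm. 2 (p. 67)] [cite: vanGeemen1994HodgeAV, Lemma 3.7] -/
theorem hodgeConjectureFor_powSucc_of_isIsogenous_sq_of_quaternionAlgHom_real_quadratic {Y P : AbelianVariety ℂ}
    {K Q : Type} [Field K] [NumberField K] [NumberField.IsTotallyReal K] [Ring Q] [Algebra ℚ Q] [Algebra K Q]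
    [IsScalarTower ℚ K Q] [IsQuaternionAlgebra K Q] (hK : Module.finrank ℚ K = 2) (hY : Y.IsSimple)
    (φ : Q →ₐ[ℚ] Y.endAlgebra) (h4 : Y.dim = 4) (hP : P.IsIsogenous (Y.powSucc 1)) (k : ℕ) :
    HodgeConjectureFor (P.powSucc k).dim (P.powSucc k).X :=
  hodgeConjectureFor_powSucc_of_isIsogenous_powSucc_of_isSimple_of_quaternionAlgHom K hY φ (by rw [hK, h4]) hP k

end Summit.HodgeConjecture.HodgeConjecture.Ring2.WeilCoverage

end
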